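import Mathlib
import HarnessLib

/-!
# Roth's theorem after Schmidt (LNM 785, Ch. V) — §9: the one-variable Wronskian criterion

Source: W. M. Schmidt, *Diophantine Approximation*, LNM 785 (1980), Ch. V §9 [Schmidt1980]
(Remark before Lemma 9A: for `m = 1` the generalized Wronskian is the ordinary Wronskian);
E. Bombieri, W. Gubler, *Heights in Diophantine Geometry* (2006), Prop. 6.3.10 [BombieriGubler2006]
("Wronski's well-known result", used but not proved there).

**The Wronskian criterion** (`Roth.hwronskian_ne_zero`): if `f₀, …, f_{k-1} ∈ K[X]` are linearly
independent over a field `K` of characteristic `0`, then the (Hasse-normalised) Wronskian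
`det ((1/i!) f_j^{(i)})_{i,j<k} = det (hasseDeriv i f_j)` is not the zero polynomial.
Mathlib has only the `2 × 2` Wronskian (`Polynomial.wronskian`). Proof given here (elementary
linear algebra, no division of rational functions): by column operations
(`Roth.exists_linIndep_natDegree_injective`) the family may be replaced by one spanning the same
space with pairwise distinct degrees, which changes the Wronskian by a non-zero constant factor
(`Roth.hwronskian_linComb`); for pairwise distinct degrees `n_j` the coefficient of
`X^{Σ n_j}` in `det (X^i · (1/i!) f_j^{(i)})` is `Π_j lc(f_j) · det (C(n_j, i))`, and the binomial
determinant is a Vandermonde determinant divided by `Π i!` (`Roth.det_choose_ne_zero`).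

## References

* [Schmidt1980] W. M. Schmidt, *Diophantine Approximation*, LNM 785, Springer 1980, Ch. V §9.
* [BombieriGubler2006] E. Bombieri, W. Gubler, *Heights in Diophantine Geometry*, CUP 2006,
  Proposition 6.3.10.
-/

noncomputable section

open Polynomial Finset Matrix

namespace Literature.NumberTheory.DiophantineGeometry

namespace Roth

variable {K : Type*} [Field K]

/-! ### The Hasse–Wronskian of a finite family -/

/-- The (Hasse-normalised) Wronskian `det ((1/i!) f_j^{(i)})_{i,j<k}` of `f₀, …, f_{k-1} ∈ K[X]`;
for `m = 1` this is the generalized Wronskian of Schmidt §9 (up to the non-zero factors `1/i!`).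
[cite: Schmidt1980, Ch. V §9 (Remark)] -/
def hwronskian {k : ℕ} (f : Fin k → K[X]) : K[X] :=
  det (of fun i j : Fin k => hasseDeriv (i : ℕ) (f j))

/-- **Column operations**: replacing `f` by the linear combinations `Σ_l M_{lj} f_l` multiplies
the Wronskian by `det M`. [folklore] -/
theorem hwronskian_linComb {k : ℕ} (f : Fin k → K[X]) (M : Matrix (Fin k) (Fin k) K) :
    hwronskian (fun j => ∑ l, M l j • f l) = hwronskian f * C M.det := by
  unfold hwronskian
  have hmat : (of fun i j : Fin k => hasseDeriv (i : ℕ) (∑ l, M l j • f l)) =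
      (of fun i l : Fin k => hasseDeriv (i : ℕ) (f l)) * M.map C := by
    refine Matrix.ext fun i j => ?_
    simp only [of_apply, Matrix.mul_apply, Matrix.map_apply, map_sum, map_smul]
    apply Finset.sum_congr rfl
    intro l _
    rw [smul_eq_C_mul, mul_comm]
  rw [hmat, det_mul, RingHom.map_det]
  rfl

/-! ### The top coefficient of a determinant of polynomials -/

/-- Coefficient of `X^{Σ n_i}` in a product of polynomials of degrees `≤ n_i`. [folklore] -/
theorem coeff_prod_of_natDegree_le {ι : Type*} (s : Finset ι) (g : ι → K[X]) (n : ι → ℕ)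
    (h : ∀ i ∈ s, (g i).natDegree ≤ n i) :
    (∏ i ∈ s, g i).natDegree ≤ ∑ i ∈ s, n i ∧
      (∏ i ∈ s, g i).coeff (∑ i ∈ s, n i) = ∏ i ∈ s, (g i).coeff (n i) := by
  classical
  induction s using Finset.induction_on with
  | empty => simp
  | insert a s ha ih =>
    obtain ⟨ih1, ih2⟩ := ih fun i hi => h i (mem_insert_of_mem hi)
    have ha' := h a (mem_insert_self a s)
    rw [prod_insert ha, sum_insert ha, prod_insert ha]
    refine ⟨(natDegree_mul_le).trans (add_le_add ha' ih1), ?_⟩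
    rw [coeff_mul_add_eq_of_natDegree_le ha' ih1, ih2]

/-- **Top coefficient of a determinant**: if the entries of column `j` have degree `≤ n_j`, then
the coefficient of `X^{Σ n_j}` in `det A` is the determinant of the coefficients of `X^{n_j}`.
[folklore] -/
theorem coeff_det_of_natDegree_le {k : ℕ} (A : Matrix (Fin k) (Fin k) K[X]) (n : Fin k → ℕ)
    (h : ∀ i j, (A i j).natDegree ≤ n j) :
    (det A).coeff (∑ j, n j) = det (of fun i j => (A i j).coeff (n j)) := by
  rw [det_apply, det_apply, finsetSum_coeff]
  refine sum_congr rfl fun σ _ => ?_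
  rw [Units.smul_def, Units.smul_def, coeff_smul]
  congr 1
  have := (coeff_prod_of_natDegree_le univ (fun i => A (σ i) i) n fun i _ => h (σ i) i).2
  simpa using this

/-! ### The binomial determinant `det (C(n_j, i))` -/

/-- For pairwise distinct natural numbers `n₀, …, n_{k-1}` the binomial determinant
`det (C(n_j, i))_{i,j<k}` is non-zero in characteristic `0`: up to the factor `Π_i i!` it is the
Vandermonde determinant of the `n_j` (via the falling factorials `X(X-1)⋯(X-i+1)`). [folklore] -/
theorem det_choose_ne_zero [CharZero K] {k : ℕ} (n : Fin k → ℕ) (hn : Function.Injective n) :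
    det (of fun i j : Fin k => ((n j).choose (i : ℕ) : K)) ≠ 0 := by
  set v : Fin k → K := fun j => (n j : K) with hv
  have hvinj : Function.Injective v := fun a b hab => hn (Nat.cast_injective (R := K) hab)
  have hV : (vandermonde v).det ≠ 0 := det_vandermonde_ne_zero_iff.mpr hvinj
  have hP := det_eval_matrixOfPolynomials_eq_det_vandermonde v (fun j => descPochhammer K j)
    (fun j => descPochhammer_natDegree K j) (fun j => monic_descPochhammer K j)
  -- the evaluated matrix is `(i, j) ↦ j! · C(n_i, j)`, the transpose of ours with scaled columns
  have hE : (of fun i j : Fin k => (descPochhammer K j).eval (v i)) =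
      of fun i j : Fin k => ((j : ℕ).factorial : K) * ((n i).choose (j : ℕ) : K) := by
    refine Matrix.ext fun i j => ?_
    simp only [of_apply, hv, descPochhammer_eval_eq_descFactorial,
      Nat.descFactorial_eq_factorial_mul_choose, Nat.cast_mul]
  rw [hP, hE, det_mul_row] at hV
  have ht : (of fun i j : Fin k => ((n j).choose (i : ℕ) : K)) =
      (of fun i j : Fin k => ((n i).choose (j : ℕ) : K))ᵀ := by
    refine Matrix.ext fun i j => ?_; rfl
  rw [ht, det_transpose]
  exact right_ne_zero_of_mul hV

/-! ### Distinct degrees give a non-zero Wronskian -/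

/-- If `f₀, …, f_{k-1}` are non-zero with pairwise distinct degrees `n_j`, then the coefficient of
`X^{Σ n_j}` in `det (X^i · (1/i!) f_j^{(i)}) = X^{0+1+⋯+(k-1)} · W` is `Π lc(f_j) · det (C(n_j,i)) ≠ 0`,
so `W ≠ 0`. [folklore] -/
theorem hwronskian_ne_zero_of_natDegree_injective [CharZero K] {k : ℕ} (g : Fin k → K[X])
    (h0 : ∀ j, g j ≠ 0) (hinj : Function.Injective fun j => (g j).natDegree) :
    hwronskian g ≠ 0 := by
  set n : Fin k → ℕ := fun j => (g j).natDegree with hn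
  set A : Matrix (Fin k) (Fin k) K[X] := of fun i j => X ^ (i : ℕ) * hasseDeriv (i : ℕ) (g j)
    with hA
  have hdetA : det A = (∏ i : Fin k, (X : K[X]) ^ (i : ℕ)) * hwronskian g := by
    rw [hA, hwronskian]
    exact det_mul_column (fun i : Fin k => (X : K[X]) ^ (i : ℕ)) _
  have hdeg : ∀ i j, (A i j).natDegree ≤ n j := by
    intro i j
    rw [hA, of_apply]
    by_cases hij : (i : ℕ) ≤ n j
    · calc (X ^ (i : ℕ) * hasseDeriv (i : ℕ) (g j)).natDegree
          ≤ (X ^ (i : ℕ) : K[X]).natDegree + (hasseDeriv (i : ℕ) (g j)).natDegree := natDegree_mul_le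
        _ ≤ i + (n j - i) := add_le_add (natDegree_X_pow_le _) (natDegree_hasseDeriv_le _ _)
        _ = n j := by omega
    · rw [hasseDeriv_eq_zero_of_lt_natDegree _ _ (not_le.mp hij), mul_zero, natDegree_zero]
      exact Nat.zero_le _
  have hcoeff : ∀ i j, (A i j).coeff (n j) = ((n j).choose (i : ℕ) : K) * (g j).leadingCoeff := by
    intro i j
    rw [hA, of_apply, coeff_X_pow_mul']
    split_ifs with hij
    · rw [hasseDeriv_coeff, Nat.sub_add_cancel hij]
      rfl
    · rw [Nat.choose_eq_zero_of_lt (not_le.mp hij), Nat.cast_zero, zero_mul]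
  have htop := coeff_det_of_natDegree_le A n hdeg
  have hmat : (of fun i j => (A i j).coeff (n j)) =
      of fun i j : Fin k => (g j).leadingCoeff * ((n j).choose (i : ℕ) : K) := by
    refine Matrix.ext fun i j => ?_; rw [of_apply, of_apply, hcoeff, mul_comm]
  rw [hmat, det_mul_row] at htop
  have hne : (det A).coeff (∑ j, n j) ≠ 0 := by
    rw [htop]
    exact mul_ne_zero (prod_ne_zero_iff.mpr fun j _ => leadingCoeff_ne_zero.mpr (h0 j))
      (det_choose_ne_zero n hinj)
  intro hW
  apply hne
  rw [hdetA, hW, mul_zero, coeff_zero]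

/-! ### Column reduction to pairwise distinct degrees -/

/-- **Echelon form by column operations**: a linearly independent family `f₀, …, f_{k-1} ∈ K[X]`
spans the same space as some linearly independent family with pairwise distinct degrees (pick an
element of maximal degree, clear that degree from the others, and recurse). [folklore] -/
theorem exists_linIndep_natDegree_injective {k : ℕ} (f : Fin k → K[X])
    (hf : LinearIndependent K f) :
    ∃ g : Fin k → K[X], (∀ l, g l ∈ Submodule.span K (Set.range f)) ∧ LinearIndependent K g ∧
      Function.Injective fun l => (g l).natDegree := by
  induction k with
  | zero => exact ⟨f, fun l => l.elim0, hf, fun l => l.elim0⟩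
  | succ k ih =>
    -- an element of maximal degree
    obtain ⟨j₀, -, hj₀⟩ := exists_max_image (univ : Finset (Fin (k + 1))) (fun j => (f j).natDegree)
      univ_nonempty
    set D := (f j₀).natDegree with hD
    set v₀ := f j₀ with hv₀
    have hv₀0 : v₀ ≠ 0 := hf.ne_zero j₀
    have hlc : v₀.leadingCoeff ≠ 0 := leadingCoeff_ne_zero.mpr hv₀0
    -- clear the degree `D` from the other columns
    set f' : Fin k → K[X] := fun i =>
      f (j₀.succAbove i) - ((f (j₀.succAbove i)).coeff D / v₀.leadingCoeff) • v₀ with hf'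
    have hf'mem : ∀ i, f' i ∈ Submodule.span K (Set.range f) := fun i =>
      Submodule.sub_mem _ (Submodule.subset_span ⟨_, rfl⟩)
        (Submodule.smul_mem _ _ (Submodule.subset_span ⟨j₀, rfl⟩))
    have hf'deg : ∀ i, (f' i).degree < D := by
      intro i
      rw [degree_lt_iff_coeff_zero]
      intro m hm
      rw [hf']
      dsimp only
      rw [coeff_sub, coeff_smul, smul_eq_mul]
      rcases hm.lt_or_eq with hlt | heq
      · have h1 : (f (j₀.succAbove i)).coeff m = 0 :=
          coeff_eq_zero_of_natDegree_lt ((hj₀ _ (mem_univ _)).trans_lt hlt)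
        have h2 : v₀.coeff m = 0 := coeff_eq_zero_of_natDegree_lt (by rw [← hD]; exact hlt)
        rw [h1, h2, mul_zero, sub_zero]
      · rw [← heq, show v₀.coeff D = v₀.leadingCoeff from rfl, div_mul_cancel₀ _ hlc, sub_self]
    have hf'li : LinearIndependent K f' := by
      rw [Fintype.linearIndependent_iff]
      intro c hc i
      set a : Fin k → K := fun i => (f (j₀.succAbove i)).coeff D / v₀.leadingCoeff with ha
      set c' : Fin (k + 1) → K := j₀.insertNth (-∑ i, c i * a i) c with hc'
      have hsum : ∑ j, c' j • f j = 0 := by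
        rw [Fin.sum_univ_succAbove _ j₀, hc', Fin.insertNth_apply_same]
        simp only [Fin.insertNth_apply_succAbove]
        have : ∑ i, c i • f (j₀.succAbove i) = ∑ i, c i • f' i + (∑ i, c i * a i) • v₀ := by
          rw [sum_smul, ← sum_add_distrib]
          refine sum_congr rfl fun i _ => ?_
          rw [hf', ha]
          dsimp only
          rw [smul_sub, smul_smul, sub_add_cancel]
        rw [this, hc, zero_add, neg_smul, neg_add_cancel]
      have hc'0 := Fintype.linearIndependent_iff.mp hf c' hsum (j₀.succAbove i)
      rw [hc', Fin.insertNth_apply_succAbove] at hc'0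
      exact hc'0
    -- recurse
    obtain ⟨g', hg'mem, hg'li, hg'inj⟩ := ih f' hf'li
    have hspan' : Submodule.span K (Set.range f') ≤ Polynomial.degreeLT K D := by
      rw [Submodule.span_le]
      rintro _ ⟨i, rfl⟩
      exact mem_degreeLT.mpr (hf'deg i)
    have hg'deg : ∀ l, (g' l).degree < D := fun l => mem_degreeLT.mp (hspan' (hg'mem l))
    have hg'nat : ∀ l, (g' l).natDegree < D := by
      intro l
      have h1 := hg'deg l
      have h2 : g' l ≠ 0 := hg'li.ne_zero l
      rw [degree_eq_natDegree h2] at h1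
      exact_mod_cast h1
    refine ⟨Fin.cons v₀ g', ?_, ?_, ?_⟩
    · intro l
      refine Fin.cases ?_ (fun l => ?_) l
      · rw [Fin.cons_zero]; exact Submodule.subset_span ⟨j₀, rfl⟩
      · rw [Fin.cons_succ]
        exact (Submodule.span_le.mpr (by rintro _ ⟨i, rfl⟩; exact hf'mem i)) (hg'mem l)
    · rw [linearIndependent_finCons]
      refine ⟨hg'li, fun hmem => ?_⟩
      have hle : Submodule.span K (Set.range g') ≤ Polynomial.degreeLT K D :=
        (Submodule.span_le.mpr (by rintro _ ⟨l, rfl⟩; exact hg'mem l)).trans hspan'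
      have h1 : v₀.degree < D := mem_degreeLT.mp (hle hmem)
      rw [degree_eq_natDegree hv₀0, hD] at h1
      exact lt_irrefl _ (by exact_mod_cast h1)
    · have : (fun l => ((Fin.cons v₀ g' : Fin (k + 1) → K[X]) l).natDegree) =
          (Fin.cons D (fun l => (g' l).natDegree) : Fin (k + 1) → ℕ) := by
        ext l
        refine Fin.cases ?_ (fun l => ?_) l <;> simp [hD]
      rw [this, Fin.cons_injective_iff]
      exact ⟨fun ⟨l, hl⟩ => (hg'nat l).ne hl, hg'inj⟩

/-! ### The criterion -/

/-- **Wronski's criterion** (Schmidt §9 Remark; Bombieri–Gubler Prop. 6.3.10, one variable): a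
linearly independent family of polynomials over a field of characteristic `0` has non-zero
(Hasse-normalised) Wronskian. [cite: Schmidt1980, Ch. V §9 Lemma 9A (case m = 1)] -/
theorem hwronskian_ne_zero [CharZero K] {k : ℕ} (f : Fin k → K[X]) (hf : LinearIndependent K f) :
    hwronskian f ≠ 0 := by
  obtain ⟨g, hgmem, hg, hginj⟩ := exists_linIndep_natDegree_injective f hf
  have : ∀ l, ∃ c : Fin k → K, g l = ∑ j, c j • f j := fun l => by
    obtain ⟨c, hc⟩ := (Submodule.mem_span_range_iff_exists_fun K).mp (hgmem l)
    exact ⟨c, hc.symm⟩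
  choose M hM using this
  have hg' : g = fun l => ∑ j, (of fun j l => M l j) j l • f j := by
    funext l; rw [hM l]; rfl
  have hW : hwronskian g = hwronskian f * C (det (of fun j l => M l j)) := by
    rw [hg']; exact hwronskian_linComb f _
  have hg0 : hwronskian g ≠ 0 :=
    hwronskian_ne_zero_of_natDegree_injective g (fun l => hg.ne_zero l) hginj
  intro h0
  apply hg0
  rw [hW, h0, zero_mul]

end Roth

end Literature.NumberTheory.DiophantineGeometry
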